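/-
Copyright (c) 2026 the pub-hodgecm-mathlib formalisation cell (harness21).  Prover seat hodgecm-mathlib-K2E1-p09 (g6), Track B ∕ K2-LIT, h413 =
`stmt-HodgeConjecture-24833`, ENGINE E1, campaign «EIS-R7-BL-SPH-3» (the `N = 3` clone), deal (7) of the dealer K2E1-plan (g6) WAVE 1 2026-09-04T09:52:04Z
(«on ★ hand the bytes to K2E1-p09 for §2₃∕`hL2_cm_three` (N = 3 frame = ★ ι₃ LOWER∕UPPER)», ★ p859128).
-/
import Summits.HodgeConjecture.HodgeConjecture.Theorems.K2E1BLHomogeneousL2U2       -- ★ p859128 (K2E1-p02 g6) P6′ §3 at N = 2: RANK-GENERIC §1 (a.e. algebra), §2 (`hδα₂` payment), §4a `hL2_of_lt (σ₀ …)` — cited by name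
import Summits.HodgeConjecture.HodgeConjecture.Theorems.K2E1BLIotaBoundU3           -- ★ (K2E1-p02 g6) P2a-ι₃: CM `N = 3` covering comparison LOWER∕UPPER (`…lintegral…comp_pZX…_cm_three`), `measurable_supHeight_inv_pow`
import HarnessLib

/-!
# K2·E1 — `K2E1BLHomogeneousL2U3` (P6′₃ §2, «EIS-R7-BL-SPH-3»): A HOMOGENEOUS SOLUTION OF THE `𝔛`-SYSTEM IS IN `L²(G(F)∖G(𝔸), μ)` ON `U(2,1)_{L∕L⁺}` — the discharge of the
# `L²`-letter `hL2` of ★ `hunq_of_memLp_three` (this seat, p859077)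

Track B ∕ K2-LIT, crux h413 = `stmt-HodgeConjecture-24833`, route of record `HCCMUnconditional`; cell `hodgecm-mathlib`, squad K2, ENGINE E1 (campaign «EIS-R7-BL», the BL-SPH-3
clone).  Prover seat `hodgecm-mathlib-K2E1-p09` (g6).  THEOREMS ONLY (no `def`, no `instance`, no notation, no named-fact hypothesis, no `sorry`; default heartbeats); lane
`--supports stmt-HodgeConjecture-24833 --as helper` (count-neutral).  Closes no socket.

★ `K2E1BLHomogeneousL2U2` (K2E1-p02 (g6), p859128) is RANK-GENERIC in its §1 (the a.e. algebra `λ·ιψ = R(h)f₀ + b'·δ(α₂)` on `Z_{a₀}` and the essential bound on `ιψ`), §2 (the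
payment of `hδα₂`) and §4a (the head `hL2_of_lt (σ₀) …` on the transfer letter `htr`) — cited by name, not restated.  Only its §3 (the transfer `Z → 𝔛`: `ψ ∈ 𝓗_k(𝔛)` with `ψ ∘ p`
essentially bounded on `{a₀ < HZ}` is in `L²(μ)`) and §4b (`hL2_cm_two`, `σ₀ = 1`) are written for the CM pair at `N = 2`.  THIS FILE is their `N = 3` twin on `U(2,1)_{L∕L⁺}`,
byte-for-byte with `2 ↦ 3`, `σ₀ = 1 ↦ σ₀ = 2` (`1 < z.re ↦ 2 < z.re`), and the P2a-ι comparison frame replaced by its ★ `N = 3` twin (K2E1-p02 (g6), `K2E1BLIotaBoundU3`: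
`exists_pos_forall_mul_lintegral_le_lintegral_comp_pZX_cm_three` LOWER, `exists_forall_lintegral_comp_pZX_le_cm_three` UPPER, `measurable_supHeight_inv_pow`).

* §1 **`memLp_two_of_ae_norm_comp_pZX_le_cm_three (μ νG hβ hμZ k ψ) (ha₀ : 0 < a₀) (hfin : μZ {a₀ < HZ} ≠ ∞) (hM : ‖ψ ∘ p‖ ≤ M a.e. on {a₀ < HZ}) : MemLp ⇑ψ 2 μ`** (the transfer at `N = 3`).
* §2 HEAD **`hL2_cm_three`** — the `hL2` slot of ★ `hunq_of_memLp_three` BYTE-FOR-BYTE (`ι := iota hb`, `P := cnstN k a μZ`, `2 < z.re`), remaining letters `hK1`₃ (K2 shape for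
  `h i₀`), `hδι` (★ P3-C `deltaShift_comp_iota`, rank-generic), `hδα₂` (★ §2 of the `N = 2` file, rank-generic, from `α₂ z =ᵐ HZ^{2−z}`).
HONEST LABEL: HC_CM is proved only modulo the 7 printed citations (2 remaining named inputs: hLiu418 = `stmt-HodgeConjecture-24832`, h413 = `stmt-HodgeConjecture-24833`) until rung 0
closes; this file asserts no named fact and closes no socket; count-neutral.

## References
* [BernsteinLapid2019] J. Bernstein, E. Lapid, *On the meromorphic continuation of Eisenstein series*, J. Amer. Math. Soc. 37 (2024) (arXiv:1911.02342): §4 Claim 2 (p. 9), Claims 4–5 (p. 10).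
* [MoeglinWaldspurger1995] C. Mœglin, J.-L. Waldspurger, *Spectral decomposition and Eisenstein series*, CUP 1995: I.2.13, I.4.10.
* [Borel1963] A. Borel, *Some finiteness properties of adele groups over number fields*, Publ. Math. IHÉS 16 (1963): §5.
-/

set_option autoImplicit false
set_option linter.dupNamespace false  -- the mandated namespace repeats the summit's segment (`HodgeConjecture.HodgeConjecture`)

noncomputable section

open MeasureTheory MeasureTheory.Measure Set NumberField IsDedekindDomain Filter Topology Metric
open scoped NNReal ENNReal
open Literature.MeasureTheory.Group Literature.NumberTheory.Automorphic Literature.NumberTheory.Automorphic.UnitaryGroup AdelicGroupData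
open Summit.HodgeConjecture.HodgeConjecture.Cruxes.H413.K2E1BLBorelSpacesU2Defs
open Summit.HodgeConjecture.HodgeConjecture.Cruxes.H413.K2E1BLBorelOperatorsU2Defs
open Summit.HodgeConjecture.HodgeConjecture.Cruxes.H413.K2E1BLShiftBoundU2 (ae_weightedTruncMeasure_iff lintegral_weightedTruncMeasure)
open Summit.HodgeConjecture.HodgeConjecture.Cruxes.H413.K2E1BLRightConvTonelliU2 (rightConvFun_congr_ae_restrict borelQuotHeight_pos)
open Summit.HodgeConjecture.HodgeConjecture.Cruxes.H413.K2E1TruncatedCuspCompactU2 (ae_lt_borelQuotHeight_weightedTruncMeasure measurableSet_lt_borelQuotHeight)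
open Summit.HodgeConjecture.HodgeConjecture.Cruxes.H413.K2E1BLIotaUnfoldingU (measurable_pZX)
open Summit.HodgeConjecture.HodgeConjecture.Cruxes.H413.K2E1BLIotaBoundU3 (measurable_supHeight_inv_pow exists_forall_lintegral_comp_pZX_le_cm_three exists_pos_forall_mul_lintegral_le_lintegral_comp_pZX_cm_three)
open Summit.HodgeConjecture.HodgeConjecture.Cruxes.H413.K2E1BLHomogeneousL2U2 (hL2_of_lt)

namespace Summit.HodgeConjecture.HodgeConjecture.Cruxes.H413.K2E1BLHomogeneousL2U3

/-! ## §1 (CM pair, `N = 3`) The transfer: `ψ ∈ 𝓗_k(𝔛)` with `ψ ∘ p` essentially bounded high in the cusp is in `L²(μ)` -/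

section CM

variable (L : Type) [Field L] [NumberField L] [IsCMField L]
  [MeasurableSpace (quasiSplit (↥(maximalRealSubfield L)) L (IsCMField.complexConj L) 3).Adelic]
  [BorelSpace (quasiSplit (↥(maximalRealSubfield L)) L (IsCMField.complexConj L) 3).Adelic]

/-- **THE TRANSFER `Z → 𝔛` AT WEIGHT `0`** (CM pair, `N = 3`): if `ψ ∈ 𝓗_k(𝔛)` and `‖ψ ∘ p‖ ≤ M` a.e. on `{a₀ < HZ}` with `μZ{a₀ < HZ} < ∞`, then `ψ ∈ L²(𝔛, μ)`.  ★ LOWER comparison of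
P2a-ι₃ (★ `K2E1BLIotaBoundU3`, weight `0`, level `c₀ := min(c₁∕2, a₀)`): `A·∫_𝔛 |ψ|² dμ ≤ ∫_{Z_{c₀}} |ψ∘p|² dμZ`; on `{c₀ < HZ ≤ a₀}`, `|ψ∘p|² ≤ a₀^{2k}·HZ^{−2k}|ψ∘p|²`, integrated `≤ a₀^{2k}·B·‖ψ‖²_{𝓗_k(𝔛)}`
(★ UPPER comparison at weight `k`); on `{a₀ < HZ}`, `≤ M²·μZ{a₀ < HZ}`. [cite: BernsteinLapid2019, §4 Claim 4 (p. 10)] [cite: Borel1963, §5] [cite: MoeglinWaldspurger1995, I.2.13] -/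
theorem memLp_two_of_ae_norm_comp_pZX_le_cm_three
    (μ : Measure (quasiSplit (↥(maximalRealSubfield L)) L (IsCMField.complexConj L) 3).automorphicQuotient)
    [(quasiSplit (↥(maximalRealSubfield L)) L (IsCMField.complexConj L) 3).IsAutomorphicMeasure μ]
    (νG : Measure (quasiSplit (↥(maximalRealSubfield L)) L (IsCMField.complexConj L) 3).Adelic) [νG.IsHaarMeasure] [νG.IsInvInvariant]
    {β : (quasiSplit (↥(maximalRealSubfield L)) L (IsCMField.complexConj L) 3).Adelic → ℝ≥0∞}
    (hβ : IsCoveringWeight ↥((arithmeticBorel (↥(maximalRealSubfield L)) L (IsCMField.complexConj L) 3).map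
      (quasiSplit (↥(maximalRealSubfield L)) L (IsCMField.complexConj L) 3).arithmeticSubgroup.subtype) β)
    {μZ : Measure (borelQuotient (↥(maximalRealSubfield L)) L (IsCMField.complexConj L) 3)}
    (hμZ : ∀ f : borelQuotient (↥(maximalRealSubfield L)) L (IsCMField.complexConj L) 3 → ℝ≥0∞, Measurable f →
      ∫⁻ z, f z ∂μZ = ∫⁻ g, β g * f (toBorelQuotient (↥(maximalRealSubfield L)) L (IsCMField.complexConj L) 3 g) ∂νG)
    (k : ℕ) (ψ : HX (↥(maximalRealSubfield L)) L (IsCMField.complexConj L) 3 k μ) {a₀ : ℝ≥0} (ha₀ : 0 < a₀)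
    (hfin : μZ {x | a₀ < borelQuotHeight (↥(maximalRealSubfield L)) L (IsCMField.complexConj L) 3 x} ≠ ∞) {M : ℝ}
    (hM : ∀ᵐ x ∂(μZ.restrict {x | a₀ < borelQuotHeight (↥(maximalRealSubfield L)) L (IsCMField.complexConj L) 3 x}),
      ‖(ψ : (quasiSplit (↥(maximalRealSubfield L)) L (IsCMField.complexConj L) 3).automorphicQuotient → ℂ)
        (pZX (↥(maximalRealSubfield L)) L (IsCMField.complexConj L) 3 x)‖ ≤ M) :
    MemLp (ψ : (quasiSplit (↥(maximalRealSubfield L)) L (IsCMField.complexConj L) 3).automorphicQuotient → ℂ) 2 μ := by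
  -- the two comparison constants and the level `c₀`
  obtain ⟨c₁, hc₁, hlow⟩ := exists_pos_forall_mul_lintegral_le_lintegral_comp_pZX_cm_three L μ νG hβ hμZ 0
  set c₀ : ℝ≥0 := min (c₁ / 2) a₀ with hc₀def
  have hc₀pos : 0 < c₀ := lt_min (half_pos hc₁) ha₀
  have hc₀lt : c₀ < c₁ := lt_of_le_of_lt (min_le_left _ _) (half_lt_self hc₁)
  obtain ⟨A, hA0, -, hA⟩ := hlow c₀ hc₀pos hc₀lt
  obtain ⟨B, hBt, hB⟩ := exists_forall_lintegral_comp_pZX_le_cm_three L μ νG hβ hμZ hc₀pos k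
  -- the function `Φ = |ψ|²` and the weights
  have hψm : Measurable (ψ : (quasiSplit (↥(maximalRealSubfield L)) L (IsCMField.complexConj L) 3).automorphicQuotient → ℂ) := (Lp.stronglyMeasurable ψ).measurable
  set Φ : (quasiSplit (↥(maximalRealSubfield L)) L (IsCMField.complexConj L) 3).automorphicQuotient → ℝ≥0∞ :=
    fun x => ‖(ψ : _ → ℂ) x‖ₑ ^ (2 : ℝ) with hΦ
  have hΦm : Measurable Φ := hψm.enorm.pow_const _
  -- `ψ ∈ 𝓗_k(𝔛)`: the weighted integral is finite
  have hwm := measurable_supHeight_inv_pow (F := ↥(maximalRealSubfield L)) (E := L) (c := IsCMField.complexConj L) k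
  have hXfin : ∫⁻ x, Φ x * (((supHeight (↥(maximalRealSubfield L)) L (IsCMField.complexConj L) 3 x)⁻¹ ^ (2 * k) : ℝ≥0) : ℝ≥0∞) ∂μ < ∞ := by
    have h2 := Lp.eLpNorm_lt_top ψ
    rw [eLpNorm_eq_lintegral_rpow_enorm_toReal two_ne_zero ENNReal.ofNat_ne_top, ENNReal.toReal_ofNat,
      ENNReal.rpow_lt_top_iff_of_pos (by norm_num : (0 : ℝ) < 1 / 2), lintegral_withDensity_eq_lintegral_mul _ hwm hΦm] at h2
    refine lt_of_le_of_lt (le_of_eq (lintegral_congr fun x => ?_)) h2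
    exact mul_comm _ _
  -- LOWER comparison at weight `0`
  have hlow0 : A * ∫⁻ x, Φ x ∂μ ≤ ∫⁻ z, Φ (pZX (↥(maximalRealSubfield L)) L (IsCMField.complexConj L) 3 z)
      ∂(weightedTruncMeasure (↥(maximalRealSubfield L)) L (IsCMField.complexConj L) 3 0 c₀ μZ) := by
    have h0 := hA Φ hΦm
    simpa only [Nat.mul_zero, pow_zero, ENNReal.coe_one, mul_one] using h0
  have hw0 : weightedTruncMeasure (↥(maximalRealSubfield L)) L (IsCMField.complexConj L) 3 0 c₀ μZ =
      μZ.restrict {z | c₀ < borelQuotHeight (↥(maximalRealSubfield L)) L (IsCMField.complexConj L) 3 z} := by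
    show (μZ.restrict _).withDensity _ = _
    rw [show (fun z : borelQuotient (↥(maximalRealSubfield L)) L (IsCMField.complexConj L) 3 =>
        ((((borelQuotHeight (↥(maximalRealSubfield L)) L (IsCMField.complexConj L) 3 z)⁻¹ ^ (2 * 0) : ℝ≥0)) : ℝ≥0∞)) = (1 : borelQuotient (↥(maximalRealSubfield L)) L (IsCMField.complexConj L) 3 → ℝ≥0∞) from
      funext fun z => by rw [Nat.mul_zero, pow_zero, ENNReal.coe_one, Pi.one_apply], withDensity_one]
  -- the pointwise splitting on `Z_{c₀}`
  have hM' : ∀ᵐ z ∂(μZ.restrict {z | c₀ < borelQuotHeight (↥(maximalRealSubfield L)) L (IsCMField.complexConj L) 3 z}),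
      z ∈ {z | a₀ < borelQuotHeight (↥(maximalRealSubfield L)) L (IsCMField.complexConj L) 3 z} →
        ‖(ψ : _ → ℂ) (pZX (↥(maximalRealSubfield L)) L (IsCMField.complexConj L) 3 z)‖ ≤ M :=
    ae_restrict_of_ae ((ae_restrict_iff' (measurableSet_lt_borelQuotHeight a₀)).1 hM)
  have hsplit : ∀ᵐ z ∂(μZ.restrict {z | c₀ < borelQuotHeight (↥(maximalRealSubfield L)) L (IsCMField.complexConj L) 3 z}),
      Φ (pZX (↥(maximalRealSubfield L)) L (IsCMField.complexConj L) 3 z) ≤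
        ((a₀ ^ (2 * k) : ℝ≥0) : ℝ≥0∞) * (((((borelQuotHeight (↥(maximalRealSubfield L)) L (IsCMField.complexConj L) 3 z)⁻¹ ^ (2 * k) : ℝ≥0)) : ℝ≥0∞) * Φ (pZX (↥(maximalRealSubfield L)) L (IsCMField.complexConj L) 3 z))
          + {z | a₀ < borelQuotHeight (↥(maximalRealSubfield L)) L (IsCMField.complexConj L) 3 z}.indicator (fun _ => ENNReal.ofReal M ^ (2 : ℝ)) z := by
    filter_upwards [hM'] with z hz
    by_cases hza : a₀ < borelQuotHeight (↥(maximalRealSubfield L)) L (IsCMField.complexConj L) 3 z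
    · rw [Set.indicator_of_mem (show z ∈ {z | a₀ < borelQuotHeight (↥(maximalRealSubfield L)) L (IsCMField.complexConj L) 3 z} from hza)]
      refine le_add_left (ENNReal.rpow_le_rpow ?_ (by norm_num))
      rw [← ofReal_norm]
      exact ENNReal.ofReal_le_ofReal (hz hza)
    · rw [Set.indicator_of_notMem (show z ∉ {z | a₀ < borelQuotHeight (↥(maximalRealSubfield L)) L (IsCMField.complexConj L) 3 z} from hza), add_zero, ← mul_assoc]
      have h1 : (1 : ℝ≥0∞) ≤ ((a₀ ^ (2 * k) : ℝ≥0) : ℝ≥0∞) * ((((borelQuotHeight (↥(maximalRealSubfield L)) L (IsCMField.complexConj L) 3 z)⁻¹ ^ (2 * k) : ℝ≥0)) : ℝ≥0∞) := by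
        rw [← ENNReal.coe_mul, ← mul_pow, ENNReal.one_le_coe_iff]
        exact one_le_pow₀ ((le_mul_inv_iff₀ (borelQuotHeight_pos z)).2 (by rw [one_mul]; exact not_lt.1 hza))
      calc Φ (pZX (↥(maximalRealSubfield L)) L (IsCMField.complexConj L) 3 z) = 1 * Φ (pZX (↥(maximalRealSubfield L)) L (IsCMField.complexConj L) 3 z) := (one_mul _).symm
        _ ≤ _ := mul_le_mul_of_nonneg_right h1 zero_le
  -- integrate the splitting
  have hint : ∫⁻ z, Φ (pZX (↥(maximalRealSubfield L)) L (IsCMField.complexConj L) 3 z)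
      ∂(weightedTruncMeasure (↥(maximalRealSubfield L)) L (IsCMField.complexConj L) 3 0 c₀ μZ) ≤
        ((a₀ ^ (2 * k) : ℝ≥0) : ℝ≥0∞) * (B * ∫⁻ x, Φ x * (((supHeight (↥(maximalRealSubfield L)) L (IsCMField.complexConj L) 3 x)⁻¹ ^ (2 * k) : ℝ≥0) : ℝ≥0∞) ∂μ)
          + ENNReal.ofReal M ^ (2 : ℝ) * μZ {z | a₀ < borelQuotHeight (↥(maximalRealSubfield L)) L (IsCMField.complexConj L) 3 z} := by
    rw [hw0]
    refine (lintegral_mono_ae hsplit).trans ?_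
    have hwk : ∫⁻ z in {z | c₀ < borelQuotHeight (↥(maximalRealSubfield L)) L (IsCMField.complexConj L) 3 z},
        ((((borelQuotHeight (↥(maximalRealSubfield L)) L (IsCMField.complexConj L) 3 z)⁻¹ ^ (2 * k) : ℝ≥0)) : ℝ≥0∞) *
          Φ (pZX (↥(maximalRealSubfield L)) L (IsCMField.complexConj L) 3 z) ∂μZ =
        ∫⁻ z, Φ (pZX (↥(maximalRealSubfield L)) L (IsCMField.complexConj L) 3 z) ∂(weightedTruncMeasure (↥(maximalRealSubfield L)) L (IsCMField.complexConj L) 3 k c₀ μZ) :=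
      (lintegral_weightedTruncMeasure μZ k c₀ (g := fun z => Φ (pZX (↥(maximalRealSubfield L)) L (IsCMField.complexConj L) 3 z)) (hΦm.comp measurable_pZX)).symm
    rw [lintegral_add_right _ (measurable_const.indicator (measurableSet_lt_borelQuotHeight a₀)), lintegral_const_mul' _ _ ENNReal.coe_ne_top,
      lintegral_indicator_const (measurableSet_lt_borelQuotHeight a₀), hwk]
    exact add_le_add (mul_le_mul_of_nonneg_left (hB Φ hΦm) zero_le) (mul_le_mul_of_nonneg_left (Measure.restrict_apply_le _ _) zero_le)
  -- everything is finite
  have hfinite : A * ∫⁻ x, Φ x ∂μ < ∞ := by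
    refine lt_of_le_of_lt (hlow0.trans hint) (ENNReal.add_lt_top.2 ⟨?_, ?_⟩)
    · exact ENNReal.mul_lt_top ENNReal.coe_lt_top (ENNReal.mul_lt_top (lt_top_iff_ne_top.2 hBt) hXfin)
    · exact ENNReal.mul_lt_top (ENNReal.rpow_lt_top_of_nonneg (by norm_num) ENNReal.ofReal_ne_top) (lt_top_iff_ne_top.2 hfin)
  have hΦfin : ∫⁻ x, Φ x ∂μ < ∞ := by
    rcases ENNReal.mul_lt_top_iff.1 hfinite with h | h | h
    · exact h.2
    · exact absurd h hA0
    · rw [h]; exact ENNReal.zero_lt_top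
  refine ⟨(Lp.stronglyMeasurable ψ).aestronglyMeasurable, ?_⟩
  rw [eLpNorm_eq_lintegral_rpow_enorm_toReal two_ne_zero ENNReal.ofNat_ne_top, ENNReal.toReal_ofNat]
  exact ENNReal.rpow_lt_top_of_nonneg (by norm_num) hΦfin.ne

/-! ## §2 THE CM HEAD (`N = 3`, `σ₀ = 2`): the letter `hL2` of P6′ §2 `hunq_of_memLp_three` (★ p859077) -/

/-- **ITEM (i) FOR THE CM PAIR AT `N = 3`: A HOMOGENEOUS SOLUTION IS IN `L²(μ)`** — the `hL2` slot of ★∕📤 P6′ §2 `hunq_of_memLp_three` (★ p859077) BYTE-FOR-BYTE (`ι := iota hb`, `P := cnstN k a μZ`), with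
the transfer discharged by §1 (★ P2a-ι₃ comparison frame `(L μ νG hβ hμZ)`).  Remaining letters: K2's `hK1` for `h i₀` at `N = 3` ((2b)₃-HN chain, K2E4-p23), P3-C's `hδι` (★ `deltaShift_comp_iota`), and the essential
bound `hδα₂` of `δ(α₂ z)` (§2 `exists_ae_norm_deltaShift_le_of_ae_eq_cpow` from ★ P8-β's `α₂ z =ᵐ HZ^{2−z}`).  So P8 proper's `hunq` is ★ modulo `hK1`.
[cite: BernsteinLapid2019, §4 Claim 2 (p. 9), Claims 4–5 (p. 10)] [cite: MoeglinWaldspurger1995, I.4.10] -/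
theorem hL2_cm_three
    (μ : Measure (quasiSplit (↥(maximalRealSubfield L)) L (IsCMField.complexConj L) 3).automorphicQuotient)
    [(quasiSplit (↥(maximalRealSubfield L)) L (IsCMField.complexConj L) 3).IsAutomorphicMeasure μ]
    (νG : Measure (quasiSplit (↥(maximalRealSubfield L)) L (IsCMField.complexConj L) 3).Adelic) [νG.IsHaarMeasure] [νG.IsInvInvariant]
    {β : (quasiSplit (↥(maximalRealSubfield L)) L (IsCMField.complexConj L) 3).Adelic → ℝ≥0∞}
    (hβ : IsCoveringWeight ↥((arithmeticBorel (↥(maximalRealSubfield L)) L (IsCMField.complexConj L) 3).map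
      (quasiSplit (↥(maximalRealSubfield L)) L (IsCMField.complexConj L) 3).arithmeticSubgroup.subtype) β)
    {μZ : Measure (borelQuotient (↥(maximalRealSubfield L)) L (IsCMField.complexConj L) 3)}
    (hμZ : ∀ f : borelQuotient (↥(maximalRealSubfield L)) L (IsCMField.complexConj L) 3 → ℝ≥0∞, Measurable f →
      ∫⁻ z, f z ∂μZ = ∫⁻ g, β g * f (toBorelQuotient (↥(maximalRealSubfield L)) L (IsCMField.complexConj L) 3 g) ∂νG)
    (k n : ℕ) {I : Type*} (i₀ : I) {h : I → (quasiSplit (↥(maximalRealSubfield L)) L (IsCMField.complexConj L) 3).Adelic → ℂ}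
    {a a₀ : ℝ≥0} (ha₀ : 0 < a₀) (haa₀ : a ≤ a₀) (hfin : μZ {z | a < borelQuotHeight (↥(maximalRealSubfield L)) L (IsCMField.complexConj L) 3 z} ≠ ∞)
    (hb : IotaBound (↥(maximalRealSubfield L)) L (IsCMField.complexConj L) 3 k a μ μZ)
    (hs : ShiftBound (↥(maximalRealSubfield L)) L (IsCMField.complexConj L) 3 k a a₀ νG μZ (h i₀))
    (T : I → HX (↥(maximalRealSubfield L)) L (IsCMField.complexConj L) 3 k μ →L[ℂ] HX (↥(maximalRealSubfield L)) L (IsCMField.complexConj L) 3 k μ)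
    (hδι : deltaShift hs ∘L iota hb = restrHN (↥(maximalRealSubfield L)) L (IsCMField.complexConj L) 3 k haa₀ μZ ∘L iota hb ∘L T i₀)
    {C m : ℝ} (hC : 0 ≤ C) (hm : 0 ≤ m)
    (hK1 : ∀ f : HNcusp (↥(maximalRealSubfield L)) L (IsCMField.complexConj L) 3 k a μZ,
      ∀ᵐ x ∂(weightedTruncMeasure (↥(maximalRealSubfield L)) L (IsCMField.complexConj L) 3 k a₀ μZ),
        ‖rightConvFun (↥(maximalRealSubfield L)) L (IsCMField.complexConj L) 3 νG (h i₀)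
            ((f : HN (↥(maximalRealSubfield L)) L (IsCMField.complexConj L) 3 k a μZ) : borelQuotient (↥(maximalRealSubfield L)) L (IsCMField.complexConj L) 3 → ℂ) x‖ ≤
          C * ‖f‖ * ((borelQuotHeight (↥(maximalRealSubfield L)) L (IsCMField.complexConj L) 3 x : ℝ)) ^ (-m))
    (α₂ : ℂ → HN (↥(maximalRealSubfield L)) L (IsCMField.complexConj L) 3 k a μZ)
    (hδα₂ : ∀ z ∈ ball (0 : ℂ) (n + 2), 2 < z.re → ∃ M : ℝ, ∀ᵐ x ∂(weightedTruncMeasure (↥(maximalRealSubfield L)) L (IsCMField.complexConj L) 3 k a₀ μZ),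
      ‖(deltaShift hs (α₂ z) : borelQuotient (↥(maximalRealSubfield L)) L (IsCMField.complexConj L) 3 → ℂ) x‖ ≤ M)
    {X' : Type*} [NormedAddCommGroup X'] [NormedSpace ℂ X'] (Q : HX (↥(maximalRealSubfield L)) L (IsCMField.complexConj L) 3 k μ →L[ℂ] X') :
    ∀ z ∈ ball (0 : ℂ) (n + 2), 2 < z.re → (∫ x, h i₀ x * (((borelHeight x : ℝ≥0) : ℝ) : ℂ) ^ z ∂νG).im ≠ 0 →
      ∀ (ψ : HX (↥(maximalRealSubfield L)) L (IsCMField.complexConj L) 3 k μ) (b' : ℂ),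
        (∀ i, T i ψ = (∫ x, h i x * (((borelHeight x : ℝ≥0) : ℝ) : ℂ) ^ z ∂νG) • ψ) →
          cnstN (↥(maximalRealSubfield L)) L (IsCMField.complexConj L) 3 k a μZ (iota hb ψ) = b' • α₂ z → Q ψ = 0 →
            MemLp (ψ : (quasiSplit (↥(maximalRealSubfield L)) L (IsCMField.complexConj L) 3).automorphicQuotient → ℂ) 2 μ :=
  have hfin₀ : μZ {z | a₀ < borelQuotHeight (↥(maximalRealSubfield L)) L (IsCMField.complexConj L) 3 z} ≠ ∞ :=
    ((measure_mono fun _ hz => lt_of_le_of_lt haa₀ hz).trans_lt (lt_top_iff_ne_top.2 hfin)).ne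
  hL2_of_lt 2 n i₀ ha₀ haa₀ hb hs T hδι hC hm hK1 α₂ hδα₂ (fun ψ _ hM => memLp_two_of_ae_norm_comp_pZX_le_cm_three L μ νG hβ hμZ k ψ ha₀ hfin₀ hM) Q

end CM

end Summit.HodgeConjecture.HodgeConjecture.Cruxes.H413.K2E1BLHomogeneousL2U3

end
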